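import Literature.RingTheory.RegularLocalRing.SopRegular
import Literature.AlgebraicGeometry.Resolution.QuasiRegularSequences
import Literature.AlgebraicGeometry.Resolution.KunzRegularityCriterionProofs
import Literature.AlgebraicGeometry.Resolution.RegularSystemOfParameters
import Literature.RingTheory.Length.LengthEqFinrank
import Mathlib.RingTheory.MvPolynomial.Homogeneous
import Mathlib.Algebra.CharP.Frobenius
import HarnessLib

/-!
# Length of a regular local ring modulo powers of a regular system of parameters;
# colength of the Frobenius power `𝔪^{[q]}` of the maximal ideal

`Literature/RingTheory/RegularLocalRing/SopPowersLength.lean`, namespace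
`Literature.RingTheory.RegularLocalRing` (sibling of `SopRegular.lean`). Everything is PROVED; no
definitions, no named facts.

Let `(A, 𝔪)` be a regular local ring of dimension `d` and `x₁, …, x_d` a regular system of
parameters (`𝔪 = (x₁, …, x_d)`). For exponents `eᵢ ≥ 1`:

* `length_quotient_span_rsop_pow` — **`ℓ_A(A ⧸ (x₁^{e₁}, …, x_d^{e_d})) = e₁ ⋯ e_d`**, in every
  characteristic (the case `eᵢ = 1` is `ℓ_A(A ⧸ 𝔪) = 1`; the general count is Lech's lemma
  [Stacks 0EBY] fed with the independence of `x^e`, which holds because `x^e` is a system of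
  parameters of the Cohen–Macaulay ring `A`, hence an `A`-sequence [Matsumura 17.4 (iii)], hence
  quasi-regular [Matsumura 16.2 (i), Rees]);
  `length_quotient_span_rsop_pow_const` — the case `eᵢ = q`: `ℓ_A(A ⧸ (x₁^q, …, x_d^q)) = q^d`.
* `length_quotient_map_iterateFrobenius_maximalIdeal` — generator-free form in exponential
  characteristic `p`: for the **Frobenius power** `𝔪^{[pⁿ]} := 𝔪.map (iterateFrobenius A p n)`
  (the ideal generated by the `pⁿ`-th powers of the elements of `𝔪`),
  **`ℓ_A(A ⧸ 𝔪^{[pⁿ]}) = p^{n d}`**. (For a Noetherian local ring with FLAT Frobenius this count is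
  Kunz's [Stacks 0EC0], tree `Kunz1969.length_quotient_frobeniusPower_eq`; here regularity replaces
  flatness on the input side, so no appeal to Kunz's theorem is needed.)
* `finrank_quotient_map_iterateFrobenius_maximalIdeal` — over a coefficient field `k ⊆ A` with
  trivial residue extension (`∀ r, ∃ c : k, r - c ∈ 𝔪`): `A ⧸ 𝔪^{[pⁿ]}` is finite over `k` of
  dimension `p^{n d}` (tree `Length.length_eq_finrank_of_length_ne_top`).

Supporting lemmas of independent interest (any commutative ring `A`):

* `indep_of_isWeaklyRegular` — a weakly `A`-regular sequence `f₁, …, f_r` is *independent* in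
  Lech's sense [Stacks 0EBW]: `∑ aᵢ fᵢ = 0 ⇒ aᵢ ∈ (f₁, …, f_r)` (degree-one case of Rees'
  theorem "regular ⇒ quasi-regular", tree `isQuasiRegular_of_isWeaklyRegular`).
* `length_quotient_span_pow_eq_prod_of_isWeaklyRegular` — if `(x₁, …, x_r)` is a maximal ideal and
  `x₁^{e₁}, …, x_r^{e_r}` (`eᵢ ≥ 1`) is weakly `A`-regular then
  `ℓ_A(A ⧸ (x₁^{e₁}, …, x_r^{e_r})) = e₁ ⋯ e_r`.

## Application kept in view (not formalised here)

For a smooth connected commutative group scheme `G` of dimension `g` over a field of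
characteristic `p` and `q = p^f`, the kernel of the relative `q`-Frobenius `F_q : G → G^{(q)}` is
`Spec(𝒪(G) ⧸ I_e^{[q]}) = Spec(𝒪_{G,e} ⧸ 𝔪_e^{[q]})`, a finite local scheme whose order is the
number computed here: `dim_k 𝒪_{G,e} ⧸ 𝔪_e^{[q]} = q^g`, because `𝒪_{G,e}` is a regular local ring
of dimension `g` with residue field `k`.

## References

* [Matsumura1987] H. Matsumura, *Commutative Ring Theory*, CUP 1986, Thm. 16.2 (i), Thm. 17.4 (iii),
  Thm. 17.8.
* [StacksProject] The Stacks Project, Tags 0EBW, 0EBY (Lech's lemmas), 0EC0 (Kunz).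
* [Kunz1969] E. Kunz, *Characterizations of regular local rings of characteristic `p`*,
  Amer. J. Math. 91 (1969), proof of Thm. 2.1.
* [Fulton1998] W. Fulton, *Intersection Theory*, 2nd ed., Appendix A.1 (length vs. dimension).
-/

set_option autoImplicit false

namespace Literature.RingTheory.RegularLocalRing

universe u v

open IsLocalRing RingTheory.Sequence _root_.MvPolynomial
open Literature.AlgebraicGeometry.Resolution

variable {A : Type u} [CommRing A]

/-! ## §1 Weakly regular sequences are independent (Lech) -/

/-- **A weakly regular sequence is independent in Lech's sense** (The Stacks Project, Tag 0EBW,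
definition: "`f₁, …, f_r` are independent if `∑ aᵢfᵢ = 0` implies `aᵢ ∈ (f₁, …, f_r)`"): if
`f₁, …, f_r` is a weakly `A`-regular sequence and `∑ aᵢ fᵢ = 0` then every `aᵢ ∈ (f₁, …, f_r)`.
This is the degree-one case of Rees' theorem "an `A`-sequence is quasi-regular" (Matsumura
Thm. 16.2 (i), tree `isQuasiRegular_of_isWeaklyRegular`), applied to the linear form `∑ aᵢ Xᵢ`.
[cite: Matsumura1987, Thm. 16.2 (i)] -/
theorem indep_of_isWeaklyRegular {r : ℕ} (f : Fin r → A)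
    (hf : IsWeaklyRegular A (List.ofFn f)) (a : Fin r → A) (ha : ∑ i, a i * f i = 0)
    (i : Fin r) : a i ∈ Ideal.span (Set.range f) := by
  classical
  have hq := (isQuasiRegular_def f).mp (isQuasiRegular_of_isWeaklyRegular f hf)
  set F : MvPolynomial (Fin r) A := ∑ j, C (a j) * X j with hF
  have hhom : F.IsHomogeneous 1 := by
    refine IsHomogeneous.sum _ _ _ fun j _ => ?_
    simpa using (isHomogeneous_C (σ := Fin r) (a j)).mul (isHomogeneous_X (R := A) j)
  have heval : eval f F = 0 := by
    simp only [hF, map_sum, map_mul, eval_C, eval_X]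
    exact ha
  have hcoeff : F.coeff (Finsupp.single i 1) = a i := by
    simp [hF, coeff_sum, coeff_C_mul, coeff_X, Finsupp.single_left_inj (one_ne_zero)]
  have key := hq 1 F hhom (by rw [heval]; exact zero_mem _) (Finsupp.single i 1)
  rwa [hcoeff] at key

/-! ## §2 Lech's count for a weakly regular sequence of powers -/

/-- **`ℓ_A(A ⧸ (x₁^{e₁}, …, x_r^{e_r})) = e₁ ⋯ e_r`** when `(x₁, …, x_r)` is a maximal ideal of the
commutative ring `A`, all `eᵢ ≥ 1`, and `x₁^{e₁}, …, x_r^{e_r}` is a weakly `A`-regular sequence: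
Lech's lemma (The Stacks Project, Tag 0EBY; tree `Kunz1969.length_quotient_pow_eq_prod`) whose
independence hypothesis is discharged by `indep_of_isWeaklyRegular`. Lengths are in `ℕ∞`.
[cite: StacksProject, Tag 0EBY (Lemma 51.17.4)] -/
theorem length_quotient_span_pow_eq_prod_of_isWeaklyRegular {r : ℕ} (x : Fin r → A)
    (hm : (Ideal.span (Set.range x)).IsMaximal) (e : Fin r → ℕ) (he : ∀ i, 1 ≤ e i)
    (hreg : IsWeaklyRegular A (List.ofFn fun i => x i ^ e i)) :
    Module.length A (A ⧸ Ideal.span (Set.range fun i => x i ^ e i)) = ((∏ i, e i : ℕ) : ℕ∞) :=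
  Kunz1969.length_quotient_pow_eq_prod x hm e he
    (fun a ha i => indep_of_isWeaklyRegular (fun i => x i ^ e i) hreg a ha i)

/-! ## §3 Regular local rings: powers of a regular system of parameters -/

/-- `Ideal.ofList (List.ofFn f)` is the ideal generated by the range of `f`. [folklore] -/
private theorem ofList_ofFn_eq_span_range {r : ℕ} (f : Fin r → A) :
    Ideal.ofList (List.ofFn f) = Ideal.span (Set.range f) := by
  rw [Ideal.ofList]
  congr 1
  ext y
  simp [List.mem_ofFn']

/-- For exponents `eᵢ ≤ E`, `(x₁^E, …, x_r^E) ⊆ (x₁^{e₁}, …, x_r^{e_r})`. [folklore] -/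
private theorem span_range_pow_le_span_range_pow_of_le {r : ℕ} (x : Fin r → A) {e : Fin r → ℕ} {E : ℕ}
    (hE : ∀ i, e i ≤ E) :
    Ideal.span (Set.range fun i => x i ^ E) ≤ Ideal.span (Set.range fun i => x i ^ e i) := by
  refine Ideal.span_le.mpr ?_
  rintro _ ⟨i, rfl⟩
  have h : x i ^ E = x i ^ (E - e i) * x i ^ e i := by
    rw [← pow_add, Nat.sub_add_cancel (hE i)]
  change x i ^ E ∈ Ideal.span (Set.range fun i => x i ^ e i)
  rw [h]
  exact Ideal.mul_mem_left _ _ (Ideal.subset_span ⟨i, rfl⟩)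

/-- A power of the maximal ideal lies in the ideal of the powers of a regular system of
parameters: if `(x₁, …, x_d) = 𝔪` and `eᵢ ≤ E` then `𝔪^{dE+1} ⊆ (x₁^{e₁}, …, x_d^{e_d})`
("by looking at monomials", tree `Kunz1969.pow_span_le_span_pow`). [cite: StacksProject, Tag 0EC0 (proof)] -/
theorem maximalIdeal_pow_le_span_range_pow [IsLocalRing A] {d : ℕ} (x : Fin d → A)
    (hx : Ideal.span (Set.range x) = maximalIdeal A) {e : Fin d → ℕ} {E : ℕ} (hE : ∀ i, e i ≤ E) :
    maximalIdeal A ^ (d * E + 1) ≤ Ideal.span (Set.range fun i => x i ^ e i) := by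
  rw [← hx]
  exact (Kunz1969.pow_span_le_span_pow x E).trans (span_range_pow_le_span_range_pow_of_le x hE)

/-- **Powers of a regular system of parameters form a regular sequence**: in a regular local
ring `(A, 𝔪)` of dimension `d` with `𝔪 = (x₁, …, x_d)`, for all `eᵢ ≥ 1` the sequence
`x₁^{e₁}, …, x_d^{e_d}` is `A`-regular (it is a system of parameters; Matsumura Thm. 17.4 (iii)
with 17.8, tree `isRegular_of_maximalIdeal_pow_le_ofList`). [cite: Matsumura1987, Thm. 17.4 (iii)] -/
theorem isRegular_rsop_pow [IsRegularLocalRing A] {d : ℕ} (x : Fin d → A)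
    (hx : Ideal.span (Set.range x) = maximalIdeal A) (hd : ringKrullDim A = d) (e : Fin d → ℕ)
    (he : ∀ i, 1 ≤ e i) : IsRegular A (List.ofFn fun i => x i ^ e i) := by
  have hmem : ∀ q ∈ List.ofFn (fun i => x i ^ e i), q ∈ maximalIdeal A := by
    intro q hq
    obtain ⟨i, rfl⟩ := (List.mem_ofFn' _ _).mp hq
    exact Ideal.pow_mem_of_mem _ (hx ▸ Ideal.subset_span ⟨i, rfl⟩) _ (he i)
  have hlen : ((List.ofFn fun i => x i ^ e i).length : WithBot ℕ∞) = ringKrullDim A := by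
    rw [List.length_ofFn, hd]
  refine isRegular_of_maximalIdeal_pow_le_ofList hmem hlen (N := d * (∑ i, e i) + 1) ?_
  rw [ofList_ofFn_eq_span_range]
  exact maximalIdeal_pow_le_span_range_pow x hx fun i =>
    Finset.single_le_sum (fun j _ => Nat.zero_le (e j)) (Finset.mem_univ i)

/-- **`ℓ_A(A ⧸ (x₁^{e₁}, …, x_d^{e_d})) = e₁ ⋯ e_d` for a regular system of parameters** of a
regular local ring `(A, 𝔪)` of dimension `d` (`𝔪 = (x₁, …, x_d)`, all `eᵢ ≥ 1`), in every
characteristic: Lech's count (Tag 0EBY) for the `A`-sequence `x^e` (`isRegular_rsop_pow`).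
[cite: StacksProject, Tag 0EBY (Lemma 51.17.4)] -/
theorem length_quotient_span_rsop_pow [IsRegularLocalRing A] {d : ℕ} (x : Fin d → A)
    (hx : Ideal.span (Set.range x) = maximalIdeal A) (hd : ringKrullDim A = d) (e : Fin d → ℕ)
    (he : ∀ i, 1 ≤ e i) :
    Module.length A (A ⧸ Ideal.span (Set.range fun i => x i ^ e i)) = ((∏ i, e i : ℕ) : ℕ∞) :=
  length_quotient_span_pow_eq_prod_of_isWeaklyRegular x
    (hx ▸ IsLocalRing.maximalIdeal.isMaximal A) e he
    (isRegular_rsop_pow x hx hd e he).toIsWeaklyRegular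

/-- **`ℓ_A(A ⧸ (x₁^q, …, x_d^q)) = q^d`** (`q ≥ 1`) for a regular system of parameters `x₁, …, x_d`
of a regular local ring of dimension `d`. [cite: StacksProject, Tag 0EBY (Lemma 51.17.4)] -/
theorem length_quotient_span_rsop_pow_const [IsRegularLocalRing A] {d : ℕ} (x : Fin d → A)
    (hx : Ideal.span (Set.range x) = maximalIdeal A) (hd : ringKrullDim A = d) {q : ℕ}
    (hq : 1 ≤ q) :
    Module.length A (A ⧸ Ideal.span (Set.range fun i => x i ^ q)) = ((q ^ d : ℕ) : ℕ∞) := by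
  rw [length_quotient_span_rsop_pow x hx hd (fun _ => q) fun _ => hq, Finset.prod_const,
    Finset.card_univ, Fintype.card_fin]

/-! ## §4 The Frobenius power `𝔪^{[pⁿ]}` of the maximal ideal -/

/-- The Frobenius power of a finitely generated ideal is generated by the powers of the
generators: `(x₁, …, x_r).map (a ↦ a^{pⁿ}) = (x₁^{pⁿ}, …, x_r^{pⁿ})` in exponential characteristic
`p` (Stacks 0EC0, proof: "`F(𝔪)A = (x₁^p, …, x_r^p)`"). [cite: StacksProject, Tag 0EC0 (proof)] -/
theorem map_iterateFrobenius_span_range (p : ℕ) [ExpChar A p] (n : ℕ) {r : ℕ} (x : Fin r → A) :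
    (Ideal.span (Set.range x)).map (iterateFrobenius A p n) =
      Ideal.span (Set.range fun i => x i ^ p ^ n) := by
  rw [Ideal.map_span, ← Set.range_comp]
  rfl

/-- A regular local ring of dimension `d` has a regular system of parameters indexed by `Fin d`
(`spanFinrank 𝔪 = dim A = d`; tree `exists_regularSystemOfParameters`). [cite: Matsumura1987, §14 p. 105] -/
theorem exists_rsop_of_ringKrullDim_eq [IsRegularLocalRing A] {d : ℕ} (hd : ringKrullDim A = d) :
    ∃ x : Fin d → A, Ideal.span (Set.range x) = maximalIdeal A := by
  obtain ⟨x, hx⟩ := exists_regularSystemOfParameters (R := A)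
  have h : (maximalIdeal A).spanFinrank = d := by
    have h := IsRegularLocalRing.spanFinrank_maximalIdeal (R := A)
    rw [hd] at h
    exact_mod_cast h
  subst h
  exact ⟨x, hx⟩

/-- **Colength of the Frobenius power of the maximal ideal of a regular local ring**: if
`(A, 𝔪)` is regular local of dimension `d` and of exponential characteristic `p`, then for
`𝔪^{[pⁿ]} := 𝔪.map (iterateFrobenius A p n)` (the ideal generated by all `a^{pⁿ}`, `a ∈ 𝔪`) one has
**`ℓ_A(A ⧸ 𝔪^{[pⁿ]}) = (pⁿ)^d`**. (Kunz's count [Stacks 0EC0] for flat Frobenius; here from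
`length_quotient_span_rsop_pow_const`, no flatness used.) [cite: Kunz1969, Thm. 2.1 (proof)] -/
theorem length_quotient_map_iterateFrobenius_maximalIdeal [IsRegularLocalRing A] (p : ℕ)
    [ExpChar A p] (n : ℕ) {d : ℕ} (hd : ringKrullDim A = d) :
    Module.length A (A ⧸ (maximalIdeal A).map (iterateFrobenius A p n)) =
      (((p ^ n) ^ d : ℕ) : ℕ∞) := by
  obtain ⟨x, hx⟩ := exists_rsop_of_ringKrullDim_eq (A := A) hd
  have hq : 1 ≤ p ^ n := Nat.one_le_pow _ _ (expChar_pos A p)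
  rw [← length_quotient_span_rsop_pow_const x hx hd hq, ← hx, map_iterateFrobenius_span_range]

/-- The special case `n = 1`: `ℓ_A(A ⧸ 𝔪^{[p]}) = p^d` for `𝔪^{[p]} = 𝔪.map (frobenius A p)`.
[cite: Kunz1969, Thm. 2.1 (proof)] -/
theorem length_quotient_map_frobenius_maximalIdeal [IsRegularLocalRing A] (p : ℕ) [ExpChar A p]
    {d : ℕ} (hd : ringKrullDim A = d) :
    Module.length A (A ⧸ (maximalIdeal A).map (frobenius A p)) = ((p ^ d : ℕ) : ℕ∞) := by
  have h := length_quotient_map_iterateFrobenius_maximalIdeal (A := A) p 1 hd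
  rwa [iterateFrobenius_one, pow_one] at h

/-! ## §5 Over a coefficient field: the order `q^d` as a vector-space dimension -/

/-- **`dim_k (A ⧸ 𝔪^{[pⁿ]}) = p^{n d}`**: if the regular local ring `(A, 𝔪)` of dimension `d` and
exponential characteristic `p` is an algebra over a field `k` with trivial residue extension
(every element of `A` is congruent to a scalar modulo `𝔪` — e.g. `A = 𝒪_{X,x}` at a `k`-rational
point), then `A ⧸ 𝔪^{[pⁿ]}` is a finite-dimensional `k`-vector space of dimension `(pⁿ)^d`. This is
the order of the kernel of the `pⁿ`-Frobenius of a smooth `d`-dimensional group at the origin.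
[cite: Fulton1998, Appendix A.1, Lemma A.1.3] -/
theorem finrank_quotient_map_iterateFrobenius_maximalIdeal {k : Type v} [Field k]
    [IsRegularLocalRing A] [Algebra k A]
    (hres : ∀ r : A, ∃ c : k, r - algebraMap k A c ∈ maximalIdeal A)
    (p : ℕ) [ExpChar A p] (n : ℕ) {d : ℕ} (hd : ringKrullDim A = d) :
    Module.Finite k (A ⧸ (maximalIdeal A).map (iterateFrobenius A p n)) ∧
      Module.finrank k (A ⧸ (maximalIdeal A).map (iterateFrobenius A p n)) = (p ^ n) ^ d := by
  have hlen := length_quotient_map_iterateFrobenius_maximalIdeal (A := A) p n hd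
  have hne : Module.length A (A ⧸ (maximalIdeal A).map (iterateFrobenius A p n)) ≠ ⊤ := by
    rw [hlen]
    exact ENat.coe_ne_top _
  refine ⟨Literature.RingTheory.Length.finite_of_length_ne_top_of_residueField hres _ hne, ?_⟩
  have h := Literature.RingTheory.Length.length_eq_finrank_of_length_ne_top hres _ hne
  rw [hlen] at h
  exact_mod_cast h.symm

/-- The same for powers of a chosen regular system of parameters with arbitrary exponents:
`dim_k (A ⧸ (x₁^{e₁}, …, x_d^{e_d})) = e₁ ⋯ e_d`. [cite: Fulton1998, Appendix A.1, Lemma A.1.3] -/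
theorem finrank_quotient_span_rsop_pow {k : Type v} [Field k] [IsRegularLocalRing A] [Algebra k A]
    (hres : ∀ r : A, ∃ c : k, r - algebraMap k A c ∈ maximalIdeal A) {d : ℕ} (x : Fin d → A)
    (hx : Ideal.span (Set.range x) = maximalIdeal A) (hd : ringKrullDim A = d) (e : Fin d → ℕ)
    (he : ∀ i, 1 ≤ e i) :
    Module.Finite k (A ⧸ Ideal.span (Set.range fun i => x i ^ e i)) ∧
      Module.finrank k (A ⧸ Ideal.span (Set.range fun i => x i ^ e i)) = ∏ i, e i := by
  have hlen := length_quotient_span_rsop_pow x hx hd e he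
  have hne : Module.length A (A ⧸ Ideal.span (Set.range fun i => x i ^ e i)) ≠ ⊤ := by
    rw [hlen]
    exact ENat.coe_ne_top _
  refine ⟨Literature.RingTheory.Length.finite_of_length_ne_top_of_residueField hres _ hne, ?_⟩
  have h := Literature.RingTheory.Length.length_eq_finrank_of_length_ne_top hres _ hne
  rw [hlen] at h
  exact_mod_cast h.symm

end Literature.RingTheory.RegularLocalRing
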